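import Mathlib
import HarnessLib
import Summits.Langlands.Langlands.Theses.SkinnerWilesDefectOne
import Summits.Langlands.Langlands.Theorems.SkinnerWilesDefectOneProModularOfEisensteinSeedNicePrimeSupply
import Literature.NumberTheory.GaloisRepresentations.DeformationProfiniteLevel

/-!
# Countable prime avoidance in complete local rings; dimension-one primes off countably many closed sets

Route `SkinnerWilesDefectOne`, crux `ReducibleOrdinaryProModular` (stmt-Langlands-12919), line
`fine-selmer-codimension-two`, helper file of stub `stub_patchingPrimeSupply` (the "supply" step of
Skinner–Wiles' Prop. 4.1: above every big prime of `R_𝒟` there is a patching prime, [SW, §4.3,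
p. 65]: "Let `𝔭 ⊇ Q₁` be a prime of dimension one not containing `c_{σ₀}, Y₁, …, Y_t`.  Such a `𝔭`
always exists.").  At defect one the avoided loci are no longer finitely many hypersurfaces but
COUNTABLY many closed subsets of `Spec R_𝒟` (the reducible locus and, for each `v ∣ p` and each
`n ≥ 1`, the locus where the `n`-th power of the nearly-ordinary inertial ratio is trivial), so the
finite prime avoidance of the landed `Theorems/…NicePrimeSupply.lean` must be replaced by COUNTABLE
prime avoidance, which holds in COMPLETE noetherian local rings (L. Burch 1972; R. Y. Sharp and
P. Vámos, Arch. Math. 44 (1985) 243–248) and fails without completeness.  PURE COMMUTATIVE ALGEBRA,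
all sorry-free, for an arbitrary complete noetherian local ring `A` / `R`:

* `exists_pow_forall_add_notMem` — ideals are `𝔪`-adically closed, ball form (Krull's intersection
  theorem, via the tree's `Deformation.mem_of_forall_mem_sup_pow`);
* `exists_mem_forall_notMem_of_isAdicComplete` — **countable prime avoidance**: `I ⊄ Pᵢ` for all
  `i ∈ ℕ` ⟹ some `x ∈ I` lies in no `Pᵢ` (an `𝔪`-adic limit of successive corrections inside
  shrinking balls missing `P₀, …, Pₙ`); `…_of_countable` — countable-set form; the registered
  sub-goal `stub_patchingPrimeSupply_auxCountableAvoidance` restates the sequence form verbatim;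
* `eq_of_mem_minimalPrimes_sup_span_singleton`, `ne_maximalIdeal_of_mem_minimalPrimes_sup_span_singleton`
  — Krull's principal ideal theorem over `R/Q` (Mathlib `Ideal.map_height_le_one_of_mem_minimalPrimes`):
  a minimal prime `P₁` of `Q + (x)` admits no prime strictly between `Q` and `P₁`, and `P₁ ≠ 𝔪` when
  `dim R/Q ≥ 2`;
* `exists_isPrime_ringKrullDim_quotient_eq_one_forall_not_le` — **above a prime `Q` with
  `dim R/Q ≥ 2` and off countably many `V(B)`, `B ⊄ Q`, there is a prime `𝔭 ⊇ Q` with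
  `dim R/𝔭 = 1`** (induction on `dim R/Q`: avoid `Q` and the non-maximal minimal primes of the
  `Q + B` by an `x ∈ 𝔪`, descend to a minimal prime of `Q + (x)`).

Mathlib searched (pin): `Ideal.subset_union_prime` (finite avoidance only), `IsPrecomplete.prec`,
`Ideal.map_height_le_one_of_mem_minimalPrimes`, `Ideal.height_strict_mono_of_isPrime_of_isPrime`,
`Ideal.finite_minimalPrimes_of_isNoetherianRing` (all used); no countable prime avoidance in Mathlib.

References: H. Matsumura, *Commutative Ring Theory* (1986), Thm. 8.10 (Krull's intersection
theorem), Thm. 13.5 (Krull's height theorem) [Matsumura1987]; C. M. Skinner, A. J. Wiles, *Residually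
reducible representations and modular forms*, Publ. Math. IHÉS 89 (1999), §4.3 [SkinnerWiles1999];
R. Y. Sharp, P. Vámos, *Baire's category theorem and prime avoidance …*, Arch. Math. 44 (1985) 243–248.
-/

set_option linter.dupNamespace false -- project-wide option (lakefile weak.linter.dupNamespace); `Summit.Langlands.Langlands` is the mandated namespace

namespace Summit.Langlands.Langlands.Theorems

open IsLocalRing

universe u

section CountablePrimeAvoidance

variable {A : Type u} [CommRing A] [IsNoetherianRing A] [IsLocalRing A]

/-- **Ideals of a noetherian local ring are `𝔪`-adically closed**, neighbourhood form: if `x ∉ J`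
then a whole `𝔪`-adic ball `x + 𝔪ᴺ` misses `J` (Krull's intersection theorem for `A/J`).
[cite: Matsumura1987, Thm. 8.10] -/
theorem exists_pow_forall_add_notMem (J : Ideal A) {x : A} (hx : x ∉ J) :
    ∃ N : ℕ, ∀ y ∈ maximalIdeal A ^ N, x + y ∉ J := by
  by_contra h
  push Not at h
  apply hx
  refine Literature.NumberTheory.GaloisRepresentations.Deformation.mem_of_forall_mem_sup_pow
    fun n => ?_
  obtain ⟨y, hy, hxy⟩ := h n
  rw [← add_sub_cancel_right x y]
  exact Ideal.sub_mem _ (Ideal.mem_sup_left hxy) (Ideal.mem_sup_right hy)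

omit [IsNoetherianRing A] in
/-- One step of the avoidance construction: for a prime `P ⊉ I` (`I` proper), any `x` and any
`N`, some `y ∈ I·𝔪ᴺ` has `x + y ∉ P` (`I·𝔪ᴺ ⊄ P` by primality, as `P ≠ 𝔪`). [folklore] -/
theorem exists_mem_mul_pow_add_notMem {I P : Ideal A} [P.IsPrime] (hIP : ¬ I ≤ P) (hI : I ≠ ⊤)
    (x : A) (N : ℕ) : ∃ y ∈ I * maximalIdeal A ^ N, x + y ∉ P := by
  by_cases hxP : x ∈ P
  · have hIN : ¬ I * maximalIdeal A ^ N ≤ P := by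
      intro hle
      rcases (Ideal.IsPrime.mul_le inferInstance).mp hle with h | h
      · exact hIP h
      · have h𝔪 : maximalIdeal A ≤ P := Ideal.IsPrime.le_of_pow_le h
        have hP𝔪 : maximalIdeal A = P :=
          (maximalIdeal.isMaximal A).eq_of_le Ideal.IsPrime.ne_top' h𝔪
        exact hIP (hP𝔪 ▸ le_maximalIdeal hI)
    obtain ⟨y, hy, hyP⟩ := SetLike.not_le_iff_exists.mp hIN
    refine ⟨y, hy, fun h => hyP ?_⟩
    have := P.sub_mem h hxP
    rwa [add_sub_cancel_left] at this
  · exact ⟨0, Submodule.zero_mem _, by rwa [add_zero]⟩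

/-- **Countable prime avoidance in a complete noetherian local ring** (Burch; Sharp–Vámos): if
an ideal `I` is contained in none of countably many primes `P₀, P₁, …`, then some element of `I`
lies in none of them.  (False without completeness: `k[X,Y]_{(X,Y)}` for countable `k`.)  Proof:
build `x₀, x₁, … ∈ I` with `xₙ ∉ Pₙ` and `x_{n+1} ≡ xₙ mod 𝔪^{Eₙ}`, the radius `Eₙ` so small that the
ball `xₙ + 𝔪^{Eₙ}` misses `Pₙ` (ideals are closed); the `𝔪`-adic limit lies in `I` (closed) and in
that ball for every `n`. [cite: Matsumura1987, Thm. 8.10] -/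
theorem exists_mem_forall_notMem_of_isAdicComplete [IsAdicComplete (maximalIdeal A) A]
    (I : Ideal A) (P : ℕ → Ideal A) (hP : ∀ i, (P i).IsPrime) (hIP : ∀ i, ¬ I ≤ P i) :
    ∃ x ∈ I, ∀ i, x ∉ P i := by
  classical
  by_cases hI : I = ⊤
  · exact ⟨1, hI ▸ Submodule.mem_top, fun i h1 => (hP i).ne_top ((Ideal.eq_top_iff_one _).mpr h1)⟩
  -- safety radius `e i x`: if `x ∉ P i` then the ball `x + 𝔪^(e i x)` misses `P i`
  have he : ∀ (i : ℕ) (x : A), ∃ N : ℕ, x ∉ P i → ∀ y ∈ maximalIdeal A ^ N, x + y ∉ P i := by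
    intro i x
    by_cases hx : x ∈ P i
    · exact ⟨0, fun h => absurd hx h⟩
    · obtain ⟨N, hN⟩ := exists_pow_forall_add_notMem (P i) hx
      exact ⟨N, fun _ => hN⟩
  choose e he using he
  -- step `g i N x ∈ I·𝔪ᴺ` with `x + g i N x ∉ P i`
  have hg : ∀ (i N : ℕ) (x : A), ∃ y ∈ I * maximalIdeal A ^ N, x + y ∉ P i := by
    intro i N x
    haveI := hP i
    exact exists_mem_mul_pow_add_notMem (hIP i) hI x N
  choose g hgI hgP using hg
  -- the sequence of pairs `(xₙ, Eₙ)`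
  obtain ⟨s, hs0, hs⟩ : ∃ s : ℕ → A × ℕ, s 0 = (0 + g 0 0 0, e 0 (0 + g 0 0 0)) ∧
      ∀ n, s (n + 1) = ((s n).1 + g (n + 1) (s n).2 (s n).1,
        (s n).2 + e (n + 1) ((s n).1 + g (n + 1) (s n).2 (s n).1) + 1) :=
    ⟨fun n => Nat.rec (0 + g 0 0 0, e 0 (0 + g 0 0 0))
      (fun n xE => (xE.1 + g (n + 1) xE.2 xE.1, xE.2 + e (n + 1) (xE.1 + g (n + 1) xE.2 xE.1) + 1))
      n, rfl, fun _ => rfl⟩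
  set x : ℕ → A := fun n => (s n).1 with hxdef
  set E : ℕ → ℕ := fun n => (s n).2 with hEdef
  have hx0 : x 0 = 0 + g 0 0 0 := by simp [hxdef, hs0]
  have hE0 : E 0 = e 0 (x 0) := by simp [hEdef, hxdef, hs0]
  have hxs : ∀ n, x (n + 1) = x n + g (n + 1) (E n) (x n) := fun n => by simp [hxdef, hEdef, hs n]
  have hEs : ∀ n, E (n + 1) = E n + e (n + 1) (x (n + 1)) + 1 := fun n => by
    simp [hxdef, hEdef, hs n]
  -- invariants
  have hxI : ∀ n, x n ∈ I := by
    intro n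
    induction n with
    | zero => rw [hx0]; exact I.add_mem I.zero_mem (Ideal.mul_le_right (hgI 0 0 0))
    | succ n ih => rw [hxs]; exact I.add_mem ih (Ideal.mul_le_right (hgI _ _ _))
  have hxP : ∀ n, x n ∉ P n := by
    intro n
    cases n with
    | zero => rw [hx0]; exact hgP 0 0 0
    | succ n => rw [hxs]; exact hgP _ _ _
  have hEmono : Monotone E :=
    monotone_nat_of_le_succ fun n => by rw [hEs]; omega
  have hEn : ∀ n, n ≤ E n := by
    intro n
    induction n with
    | zero => exact Nat.zero_le _
    | succ n ih => rw [hEs]; omega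
  have hEe : ∀ n, e n (x n) ≤ E n := by
    intro n
    cases n with
    | zero => rw [hE0]
    | succ n => rw [hEs]; omega
  have hdiff : ∀ n, x (n + 1) - x n ∈ maximalIdeal A ^ E n := fun n => by
    rw [hxs, add_sub_cancel_left]
    exact Ideal.mul_le_left (hgI _ _ _)
  have hcauchy : ∀ m d, x (m + d) - x m ∈ maximalIdeal A ^ E m := by
    intro m d
    induction d with
    | zero => simp
    | succ d ih =>
      have : x (m + (d + 1)) - x m = (x (m + d + 1) - x (m + d)) + (x (m + d) - x m) := by
        rw [← add_assoc]; ring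
      rw [this]
      exact Ideal.add_mem _
        (Ideal.pow_le_pow_right (hEmono (Nat.le_add_right m d)) (hdiff (m + d))) ih
  have hcauchy' : ∀ {m n}, m ≤ n → x n - x m ∈ maximalIdeal A ^ E m := fun {m n} hmn => by
    obtain ⟨d, rfl⟩ := Nat.exists_eq_add_of_le hmn
    exact hcauchy m d
  -- the limit
  obtain ⟨L, hL⟩ := IsPrecomplete.prec
    (IsAdicComplete.toIsPrecomplete (I := maximalIdeal A) (M := A)) (f := x) fun {m n} hmn => by
      rw [SModEq.sub_mem, smul_eq_mul, Ideal.mul_top, ← neg_sub]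
      exact Submodule.neg_mem _ (Ideal.pow_le_pow_right (hEn m) (hcauchy' hmn))
  have hL' : ∀ n, x n - L ∈ maximalIdeal A ^ n := fun n => by
    have := hL n
    rwa [SModEq.sub_mem, smul_eq_mul, Ideal.mul_top] at this
  have hL'' : ∀ n, L - x n ∈ maximalIdeal A ^ E n := fun n => by
    have : L - x n = (x (E n) - x n) - (x (E n) - L) := by ring
    rw [this]
    exact Ideal.sub_mem _ (hcauchy' (hEn n)) (hL' (E n))
  refine ⟨L, ?_, fun n => ?_⟩
  · by_contra hLI
    obtain ⟨N, hN⟩ := exists_pow_forall_add_notMem I hLI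
    exact hN (x N - L) (hL' N) (by rw [add_sub_cancel]; exact hxI N)
  · have := he n (x n) (hxP n) (L - x n) (Ideal.pow_le_pow_right (hEe n) (hL'' n))
    rwa [add_sub_cancel] at this

/-- Countable prime avoidance, for a countable SET of primes. [cite: Matsumura1987, Thm. 8.10] -/
theorem exists_mem_forall_notMem_of_countable [IsAdicComplete (maximalIdeal A) A] (I : Ideal A)
    {S : Set (Ideal A)} (hS : S.Countable) (hP : ∀ P ∈ S, P.IsPrime) (hIP : ∀ P ∈ S, ¬ I ≤ P) :
    ∃ x ∈ I, ∀ P ∈ S, x ∉ P := by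
  rcases S.eq_empty_or_nonempty with rfl | hne
  · exact ⟨0, I.zero_mem, fun P hP => hP.elim⟩
  obtain ⟨f, rfl⟩ := hS.exists_eq_range hne
  obtain ⟨x, hxI, hx⟩ := exists_mem_forall_notMem_of_isAdicComplete I f
    (fun i => hP _ ⟨i, rfl⟩) (fun i => hIP _ ⟨i, rfl⟩)
  exact ⟨x, hxI, fun P ⟨i, hi⟩ => hi ▸ hx i⟩

end CountablePrimeAvoidance

section DimensionOne

variable {R : Type u} [CommRing R] [IsNoetherianRing R]

/-- **No prime strictly between** (Krull's principal ideal theorem over `R/Q`): if `P₁` is a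
minimal prime of `Q + (x)` over a prime `Q`, then `ht(P₁/Q) ≤ 1`, so a prime `P'` with
`Q < P' ≤ P₁` equals `P₁`. [cite: Matsumura1987, Thm. 13.5] -/
theorem eq_of_mem_minimalPrimes_sup_span_singleton {Q P' P₁ : Ideal R} [Q.IsPrime] [P'.IsPrime]
    {x : R} (hP₁ : P₁ ∈ (Q ⊔ Ideal.span {x}).minimalPrimes) (hQP' : Q < P') (hP'P₁ : P' ≤ P₁) :
    P' = P₁ := by
  haveI hP₁p : P₁.IsPrime := hP₁.1.1
  have h1 := Ideal.map_height_le_one_of_mem_minimalPrimes hP₁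
  have hQP₁ : Q ≤ P₁ := hQP'.le.trans hP'P₁
  by_contra hne
  set f := Ideal.Quotient.mk Q
  haveI : (P'.map f).IsPrime := Ideal.isPrime_map_quotientMk_of_isPrime hQP'.le
  haveI : (P₁.map f).IsPrime := Ideal.isPrime_map_quotientMk_of_isPrime hQP₁
  have hlt : P'.map f < P₁.map f := by
    refine lt_of_le_of_ne (Ideal.map_mono hP'P₁) fun heq => hne ?_
    have h := congrArg (Ideal.comap f) heq
    rwa [Ideal.comap_map_of_surjective' f Ideal.Quotient.mk_surjective,
      Ideal.comap_map_of_surjective' f Ideal.Quotient.mk_surjective, Ideal.mk_ker,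
      sup_eq_left.mpr hQP'.le, sup_eq_left.mpr hQP₁] at h
  have hne_bot : P'.map f ≠ ⊥ := by
    rw [Ne, Ideal.map_eq_bot_iff_le_ker, Ideal.mk_ker]
    exact fun h => hQP'.ne (le_antisymm hQP'.le h)
  have h1' : 1 ≤ (P'.map f).height := by
    rw [Order.one_le_iff_ne_zero, Ne, Ideal.height_eq_zero_iff_eq_bot]
    exact hne_bot
  haveI : (P₁.map f).FiniteHeight :=
    (P₁.map f).finiteHeight_iff.mpr (Or.inr (ne_top_of_le_ne_top ENat.one_ne_top h1))
  have h2 := Ideal.height_strict_mono_of_isPrime_of_isPrime hlt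
  exact absurd (h1'.trans_lt (h2.trans_le h1)) (lt_irrefl _)

variable [IsLocalRing R]

/-- A minimal prime of `Q + (x)` over a prime `Q` with `dim R/Q ≥ 2` is not the maximal ideal
(`ht(𝔪/Q) = dim R/Q ≥ 2 > 1`). [cite: Matsumura1987, Thm. 13.5] -/
theorem ne_maximalIdeal_of_mem_minimalPrimes_sup_span_singleton {Q P₁ : Ideal R} [Q.IsPrime]
    {x : R} (hP₁ : P₁ ∈ (Q ⊔ Ideal.span {x}).minimalPrimes)
    (hQ : (2 : WithBot ℕ∞) ≤ ringKrullDim (R ⧸ Q)) : P₁ ≠ maximalIdeal R := by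
  intro heq
  have h1 := Ideal.map_height_le_one_of_mem_minimalPrimes hP₁
  haveI : IsLocalRing (R ⧸ Q) := .of_surjective' _ Ideal.Quotient.mk_surjective
  rw [heq, IsLocalRing.map_maximalIdeal_of_surjective _ Ideal.Quotient.mk_surjective] at h1
  obtain ⟨m, hm⟩ := Literature.AlgebraicGeometry.Motives.exists_ringKrullDim_eq_nat (R ⧸ Q)
  have h2m : 2 ≤ m := by
    rw [hm] at hQ
    exact_mod_cast hQ
  have h := IsLocalRing.maximalIdeal_height_eq_ringKrullDim (R := R ⧸ Q)
  rw [hm] at h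
  have h' : (maximalIdeal (R ⧸ Q)).height = m := by exact_mod_cast h
  rw [h'] at h1
  have h1' : m ≤ 1 := by exact_mod_cast h1
  omega

omit [IsNoetherianRing R] in
/-- `dim R/P ≥ 1` for a non-maximal prime `P` of a local ring. [folklore] -/
theorem one_le_ringKrullDim_quotient_of_ne_maximalIdeal {P : Ideal R} [P.IsPrime]
    (hP : P ≠ maximalIdeal R) : (1 : WithBot ℕ∞) ≤ ringKrullDim (R ⧸ P) := by
  have hlt : P < maximalIdeal R := lt_of_le_of_ne (le_maximalIdeal Ideal.IsPrime.ne_top') hP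
  have h := ringKrullDim_quotient_add_one_le_of_lt hlt
  have h0 : (0 : WithBot ℕ∞) ≤ ringKrullDim (R ⧸ maximalIdeal R) :=
    ringKrullDim_nonneg_of_nontrivial
  calc (1 : WithBot ℕ∞) = 0 + 1 := (zero_add 1).symm
    _ ≤ ringKrullDim (R ⧸ maximalIdeal R) + 1 := add_le_add h0 le_rfl
    _ ≤ ringKrullDim (R ⧸ P) := h

/-- The induction behind `exists_isPrime_ringKrullDim_quotient_eq_one_forall_not_le` (on
`d ≥ dim R/Q`, inside the fixed complete local ring `R`). [folklore] -/
theorem exists_isPrime_ringKrullDim_quotient_eq_one_forall_not_le_aux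
    [IsAdicComplete (maximalIdeal R) R] (𝓑 : Set (Ideal R)) (h𝓑 : 𝓑.Countable) (d : ℕ) :
    ∀ (Q : Ideal R) [Q.IsPrime], ringKrullDim (R ⧸ Q) ≤ d →
      (2 : WithBot ℕ∞) ≤ ringKrullDim (R ⧸ Q) → (∀ B ∈ 𝓑, ¬ B ≤ Q) →
        ∃ 𝔭 : Ideal R, 𝔭.IsPrime ∧ Q ≤ 𝔭 ∧ ringKrullDim (R ⧸ 𝔭) = 1 ∧ ∀ B ∈ 𝓑, ¬ B ≤ 𝔭 := by
  classical
  induction d with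
  | zero =>
    intro Q _ hd h2 _
    exact absurd (h2.trans hd) (by decide)
  | succ d ih =>
    intro Q _ hd h2 hBQ
    -- the countable set of primes to avoid: `Q` and the non-maximal minimal primes of the `Q + B`
    let S : Set (Ideal R) := {Q} ∪ ⋃ B ∈ 𝓑, {P | P ∈ (Q ⊔ B).minimalPrimes ∧ P ≠ maximalIdeal R}
    have hSc : S.Countable :=
      (Set.countable_singleton Q).union (h𝓑.biUnion fun B _ =>
        ((Ideal.finite_minimalPrimes_of_isNoetherianRing R (Q ⊔ B)).subset
          fun P hP => hP.1).countable)
    have hSp : ∀ P ∈ S, P.IsPrime := by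
      rintro P (hP | hP)
      · rw [Set.mem_singleton_iff] at hP
        rw [hP]
        infer_instance
      · simp only [Set.mem_iUnion] at hP
        obtain ⟨B, -, hPmin, -⟩ := hP
        exact hPmin.1.1
    have hSm : ∀ P ∈ S, ¬ maximalIdeal R ≤ P := by
      intro P hP hle
      have hPeq : maximalIdeal R = P :=
        (maximalIdeal.isMaximal R).eq_of_le (hSp P hP).ne_top hle
      rcases hP with hP | hP
      · rw [Set.mem_singleton_iff] at hP
        have hF : IsField (R ⧸ Q) := (Ideal.Quotient.maximal_ideal_iff_isField_quotient Q).mp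
          (by rw [← hP, ← hPeq]; exact maximalIdeal.isMaximal R)
        rw [ringKrullDim_eq_zero_of_isField hF] at h2
        exact absurd h2 (by decide)
      · simp only [Set.mem_iUnion] at hP
        obtain ⟨B, -, -, hPne⟩ := hP
        exact hPne hPeq.symm
    -- an element of `𝔪` outside all of them
    obtain ⟨x, hx𝔪, hxS⟩ := exists_mem_forall_notMem_of_countable (maximalIdeal R) hSc hSp hSm
    have hxQ : x ∉ Q := hxS Q (Or.inl rfl)
    -- a minimal prime `P₁` of `Q + (x)`
    have hle : Q ⊔ Ideal.span {x} ≤ maximalIdeal R :=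
      sup_le (le_maximalIdeal Ideal.IsPrime.ne_top') ((Ideal.span_singleton_le_iff_mem _).mpr hx𝔪)
    obtain ⟨P₁, hP₁min, -⟩ := Ideal.exists_minimalPrimes_le hle
    haveI hP₁p : P₁.IsPrime := hP₁min.1.1
    have hQP₁ : Q ≤ P₁ := le_sup_left.trans hP₁min.1.2
    have hxP₁ : x ∈ P₁ := hP₁min.1.2 (Ideal.mem_sup_right (Ideal.mem_span_singleton_self x))
    have hQP₁lt : Q < P₁ := lt_of_le_of_ne hQP₁ fun h => hxQ (by rw [h]; exact hxP₁)
    have hP₁𝔪 : P₁ ≠ maximalIdeal R :=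
      ne_maximalIdeal_of_mem_minimalPrimes_sup_span_singleton hP₁min h2
    -- the bad ideals avoid `P₁`
    have hBP₁ : ∀ B ∈ 𝓑, ¬ B ≤ P₁ := by
      intro B hB hBle
      obtain ⟨P', hP'min, hP'P₁⟩ := Ideal.exists_minimalPrimes_le (sup_le hQP₁ hBle : Q ⊔ B ≤ P₁)
      haveI : P'.IsPrime := hP'min.1.1
      have hQP' : Q < P' := lt_of_le_of_ne (le_sup_left.trans hP'min.1.2) fun h =>
        hBQ B hB (by rw [h]; exact le_sup_right.trans hP'min.1.2)
      have hP'eq : P' = P₁ := eq_of_mem_minimalPrimes_sup_span_singleton hP₁min hQP' hP'P₁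
      by_cases hP'𝔪 : P' = maximalIdeal R
      · exact hP₁𝔪 (hP'eq ▸ hP'𝔪)
      · exact hxS P' (Or.inr (Set.mem_biUnion hB ⟨hP'min, hP'𝔪⟩)) (hP'eq ▸ hxP₁)
    -- dimension bookkeeping: `1 ≤ dim R/P₁ ≤ dim R/Q - 1 ≤ d`
    haveI : IsLocalRing (R ⧸ P₁) := .of_surjective' _ Ideal.Quotient.mk_surjective
    haveI : IsLocalRing (R ⧸ Q) := .of_surjective' _ Ideal.Quotient.mk_surjective
    have h1 := one_le_ringKrullDim_quotient_of_ne_maximalIdeal hP₁𝔪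
    have hdrop := ringKrullDim_quotient_add_one_le_of_lt hQP₁lt
    obtain ⟨n, hn⟩ := Literature.AlgebraicGeometry.Motives.exists_ringKrullDim_eq_nat (R ⧸ P₁)
    obtain ⟨m, hm⟩ := Literature.AlgebraicGeometry.Motives.exists_ringKrullDim_eq_nat (R ⧸ Q)
    rw [hn, hm] at hdrop
    rw [hm] at hd
    rw [hn] at h1
    have hnm : n + 1 ≤ m := by exact_mod_cast hdrop
    have hmd : m ≤ d + 1 := by exact_mod_cast hd
    have hn1 : 1 ≤ n := by exact_mod_cast h1
    by_cases hn2 : 2 ≤ n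
    · have hdim' : ringKrullDim (R ⧸ P₁) ≤ d := by
        rw [hn]
        exact_mod_cast (by omega : n ≤ d)
      have h2' : (2 : WithBot ℕ∞) ≤ ringKrullDim (R ⧸ P₁) := by
        rw [hn]
        exact_mod_cast hn2
      obtain ⟨𝔭, h𝔭p, hP₁𝔭, h𝔭1, hB𝔭⟩ := ih P₁ hdim' h2' hBP₁
      exact ⟨𝔭, h𝔭p, hQP₁.trans hP₁𝔭, h𝔭1, hB𝔭⟩
    · refine ⟨P₁, hP₁p, hQP₁, ?_, hBP₁⟩
      rw [hn, (by omega : n = 1)]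
      rfl

/-- **Dimension-one primes above `Q` avoiding countably many closed sets.**  Let `R` be a COMPLETE
noetherian local ring, `Q` a prime with `dim R/Q ≥ 2`, and `𝓑` a countable set of ideals none of
which is contained in `Q` (countably many closed subsets `V(B)` of `Spec R` not containing `V(Q)`).
Then some prime `𝔭 ⊇ Q` with `dim R/𝔭 = 1` contains no `B ∈ 𝓑`.  Proof: induction on `dim R/Q`;
by countable prime avoidance pick `x ∈ 𝔪 ∖ Q` outside the (countably many, finitely many for each
`B`) non-maximal minimal primes of the `Q + B`; a minimal prime `P₁` of `Q + (x)` has `ht(P₁/Q) = 1`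
(Krull), hence contains no `B` (a minimal prime of `Q + B` inside `P₁` would equal `P₁ ∋ x`) and is
not maximal; recurse on `P₁`. (For finitely many `B` completeness is not needed:
`exists_isPrime_ringKrullDim_quotient_eq_one_not_le`.) [cite: Matsumura1987, Thm. 8.10 and Thm. 13.5] -/
theorem exists_isPrime_ringKrullDim_quotient_eq_one_forall_not_le
    [IsAdicComplete (maximalIdeal R) R] (Q : Ideal R) [Q.IsPrime]
    (hQ : (2 : WithBot ℕ∞) ≤ ringKrullDim (R ⧸ Q)) {𝓑 : Set (Ideal R)} (h𝓑 : 𝓑.Countable)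
    (hBQ : ∀ B ∈ 𝓑, ¬ B ≤ Q) :
    ∃ 𝔭 : Ideal R, 𝔭.IsPrime ∧ Q ≤ 𝔭 ∧ ringKrullDim (R ⧸ 𝔭) = 1 ∧ ∀ B ∈ 𝓑, ¬ B ≤ 𝔭 := by
  haveI : IsLocalRing (R ⧸ Q) := .of_surjective' _ Ideal.Quotient.mk_surjective
  obtain ⟨m, hm⟩ := Literature.AlgebraicGeometry.Motives.exists_ringKrullDim_eq_nat (R ⧸ Q)
  exact exists_isPrime_ringKrullDim_quotient_eq_one_forall_not_le_aux 𝓑 h𝓑 m Q hm.le hQ hBQ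

end DimensionOne

end Summit.Langlands.Langlands.Theorems

namespace Summit.Langlands.Langlands.Cruxes.ReducibleOrdinaryProModular.FineSelmerCodimensionTwo

/-- **Registered sub-goal `stub_patchingPrimeSupply_auxCountableAvoidance` of stub
`stub_patchingPrimeSupply` (line `fine-selmer-codimension-two`, crux stmt-Langlands-12919): countable
prime avoidance in a complete noetherian local ring** — if an ideal `I` is contained in none of the
primes `P₀, P₁, …`, some element of `I` lies in none of them
(`Theorems.exists_mem_forall_notMem_of_isAdicComplete`). [cite: Matsumura1987, Thm. 8.10] -/
theorem stub_patchingPrimeSupply_auxCountableAvoidance :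
    ∀ (A : Type) [CommRing A] [IsLocalRing A] [IsNoetherianRing A]
      [IsAdicComplete (IsLocalRing.maximalIdeal A) A] (I : Ideal A) (P : ℕ → Ideal A),
      (∀ i, (P i).IsPrime) → (∀ i, ¬ I ≤ P i) → ∃ x ∈ I, ∀ i, x ∉ P i :=
  fun _ _ _ _ _ I P hP hIP => Theorems.exists_mem_forall_notMem_of_isAdicComplete I P hP hIP

end Summit.Langlands.Langlands.Cruxes.ReducibleOrdinaryProModular.FineSelmerCodimensionTwo
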